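import Summits.ABC.IUTFork.Repair.RH2SigmaHullChosen
import Summits.ABC.IUTFork.Conditional.AbcOfSGenuineKWindowThetaSzpiroBadAll
import Summits.ABC.IUTFork.Conditional.AbcOfSOrNumKHregBad
import HarnessLib

/-!
# R-H ROUND 2, Q2 «S restricted to Σ», hull-reach family (rows 15 ⊋ 8, 16, 18) — the RE-CUT certificates: the kernel-refuted CONE binder `hreg`
# REPLACED by `hregBad` (C-R28 (3)(α)), answering referee abc-iut-rh-ref-3's BINDING KERNEL CAVEAT of 2026-08-26T22:55:30Z on this seat's composites

PROOF-ONLY file (D-0012: 0 definitions, 0 `Prop` facts, no instance, no notation; abc-iut cell, rung LADDER-ABC:A2.RESCUE.H; seat abc-iut-rh2-q2-hull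
gen 2; companions p469248 / p469830 / p470562 / p471359 / p471933 / p472572). TAKES NO SIDE on [IUTchIII] Cor. 3.12 or on any author; every R-H candidate /
datum class (Σ₁₅ slot-reach window, Σ₈, Σ₁₈, Σ₁₆) is a HYPOTHESIS SHAPE, never asserted; typed ≠ proved; instantiated ≠ endorsed; nothing here asserts abc.

THE CAVEAT (kernel fact, once for all five gen-0 composites p469830 / p470562 / p471359 / p471933 / p472572): they carry, VERBATIM from p447945 / p450130,
the blanket CONE binder `hreg`, KERNEL-REFUTED by `Conditional.not_hreg_v4` (admissible `d_mod = 2` quadratic-witness family, mixed prime `7`): kernel-true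
but VACUOUS AS TYPED; they stay as records, THIS file is their replacement. THE RE-CUT. Branch C's repair of record is C-R28 (3)(α) «`hreg ↦ hregBad`»: the hull estimate with `B_III(P,l)` off the slot-constant regime is demanded
ONLY at SZPIRO-BAD admissible `(P, l)` (`(l+5)/4 < d_mod`, or `log q^{∤2l}` above `(6l(l+5−4d_mod)/((l+4)(l−3)))·(log-diff + (1 − 1/l)·log-cond) +
(6l(l+5)/((l+4)(l−3)))·log π`); at Szpiro-good points NOTHING is consumed. Spines: abc-iut-s2-p2's `Conditional.abc_of_SH_v10K_window_szpiroBadAll`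
(p453137; explicit 3 = S_H(window ∧ bad) · NUM(deep ∧ bad) · CONE(bad)) and abc-iut-C-cert-2's `Conditional.abc_of_SH_orNum_K_szpiroBad_hregBad` (p452637;
explicit 2 = NUM-OFF(bad) · CONE(bad)). `hregBad` is neither proved nor refuted as typed (S-unit reading: `Conditional.szpiroGood_eventually_of_hregBad`).
Here the S_H binder of either spine is discharged ON A STRATUM Σ by this seat's landed DOORS at the certificates' bed:
* `abc_of_inSigma_orNum_K_szpiroBad_hregBad` — GENERIC, the sharpest shape: an arbitrary datum class `InSig` with its door `hdoor : InSig T ⟹ hSHw body`,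
  explicit 2 = NUM-OFF-Σ(bad) «at Szpiro-bad admissible `(P, l)`, every genuine datum OUTSIDE Σ satisfies `T.Cor312Of`» · CONE(bad) `hregBad`: the Q2
  sentence «S|Σ ⟹ abc» with the price of the complement of Σ named exactly (the number-level Corollary there, nothing on Σ).
* `abc_of_inSigma_v10K_window_szpiroBadAll` — GENERIC, the record's shape: explicit 3 = Σ(window ∧ bad) · NUM(deep ∧ bad) · CONE(bad); = p471933's
  `abc_of_inSigma_v10K_window_szpiroBadBoth` with `hreg ↦ hregBad`. `abc_of_sigma15_v10K_window_szpiroBadAll` — the ROW-15 INSTANCE (door p469830), binder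
  texts byte-identical to p471933's record except `hreg ↦ hregBad`; rows 8 / 18 / 16 in the companion `Repair/RH2SigmaHullRecutRows.lean`.

COUNTS. Every theorem here is WEAKER-OR-EQUAL binder by binder than the record it replaces (`hreg ⟹ hregBad` by dropping an antecedent); no binder of
theorem 1 is kernel-refuted — BUT (gen-3 WARNING, referee abc-iut-rp-m1 2026-08-27 + `Conditional.condP6_thirteen`) the Σ-binder of theorems 2–3 is
KERNEL-FALSE for every doored class missing the tier-1 Frey data (`Repair/RH2SigmaHullSigmaBinderRefute.lean`). HONEST SCOPE: whether the shallow Szpiro-bad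
admissible data lie in Σ_row for `l` in print's window is Q3 (rh2-q3-num: «YES with exponential l₀» on the hex / Frey lines — NOT for all `l`), not claimed;
`hNumBad` / `hNumOffSigmaBad` are assumption labels for the disputed inequality off Σ; `hregBad` one for the (U)-reading hull estimate at would-be
Szpiro-violating points; «`ABC` follows from these hypotheses AS TYPED», nothing more; typed ≠ proved; instantiated ≠ endorsed; refuted-as-typed ≠
refuted-in-print. [claim: Mochizuki2012, status: disputed] [cite: DupuyHilado2025, §3.9, §4.9]
[cite: Mochizuki2012, IUTchIII Cor. 3.12 p. 173–174, Step (xi-f) p. 184; IUTchIV Thm. 1.10 p. 22–31 (Step (v) p. 27–28, (viii) p. 30), Cor. 2.2 (ii) p. 44–46]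
-/

noncomputable section

open Set Function
open scoped Pointwise
namespace Summit.ABC.IUTFork.Repair.RH2SigmaHull

open Thm311 Thm311.Real Cor312 Cor312.Setting Cor312Vol Cor312Prov Literature.IUT.LogThetaLattice Literature.IUT.LogVolume
  Literature.IUT.HodgeTheaters Literature.IUT.LogVolume.ThetaData
open Literature.NumberTheory.NumberFields NumberField IsDedekindDomain Metric RHSlotReach
open Literature.NumberTheory.DiophantineGeometry.GenEll Summit.ABC.ABC.Theorems

section Recut

/-! ## §0. The certificates' column data (the binders `M … qK` of every branch-C certificate, VERBATIM), once for the whole file -/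
variable (M : ∀ (P : NFPoint) (l : ℕ) (T : Cor22.ThetaVolumeDatumAt P l), Type) [∀ P l T, Field (M P l T)] [∀ P l T, NumberField (M P l T)]
    (archPk : ∀ (P : NFPoint) (l : ℕ) (T : Cor22.ThetaVolumeDatumAt P l), letI := T.instFieldF; letI := T.instNumberFieldF; letI := T.instAlgebraF; letI := T.instFieldK;
        letI := T.instNumberFieldK; letI := T.instAlgebraK; letI := T.instFieldFbar; letI := T.instAlgebraFbar;
        letI := T.instAlgebraKFbar; letI := T.instIsElliptic;
      ∀ (j : (thetaIndex (pilotDataOfK T.D T.K)).Label) (vQ : (thetaIndex (pilotDataOfK T.D T.K)).VQ), Set ((logShellsDH (pilotDataOfK T.D T.K) (analyticLogv T.K)).Packet j vQ))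
    (archSub : ∀ (P : NFPoint) (l : ℕ) (T : Cor22.ThetaVolumeDatumAt P l), letI := T.instFieldF; letI := T.instNumberFieldF; letI := T.instAlgebraF; letI := T.instFieldK;
        letI := T.instNumberFieldK; letI := T.instAlgebraK; letI := T.instFieldFbar; letI := T.instAlgebraFbar;
        letI := T.instAlgebraKFbar; letI := T.instIsElliptic;
      ∀ (j : (thetaIndex (pilotDataOfK T.D T.K)).Label) (v : (thetaIndex (pilotDataOfK T.D T.K)).V), Set ((logShellsDH (pilotDataOfK T.D T.K) (analyticLogv T.K)).Packet j ((thetaIndex (pilotDataOfK T.D T.K)).over v)))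
    (Ψ : ∀ (P : NFPoint) (l : ℕ) (T : Cor22.ThetaVolumeDatumAt P l), letI := T.instFieldF; letI := T.instNumberFieldF; letI := T.instAlgebraF; letI := T.instFieldK;
        letI := T.instNumberFieldK; letI := T.instAlgebraK; letI := T.instFieldFbar; letI := T.instAlgebraFbar;
        letI := T.instAlgebraKFbar; letI := T.instIsElliptic;
      ℤ → ∀ v : (thetaIndex (pilotDataOfK T.D T.K)).V, v ∈ (thetaIndex (pilotDataOfK T.D T.K)).Vbad → Set ((logShellsDH (pilotDataOfK T.D T.K) (analyticLogv T.K)).StarPacket v))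
    (act : ∀ (P : NFPoint) (l : ℕ) (T : Cor22.ThetaVolumeDatumAt P l), letI := T.instFieldF; letI := T.instNumberFieldF; letI := T.instAlgebraF; letI := T.instFieldK;
        letI := T.instNumberFieldK; letI := T.instAlgebraK; letI := T.instFieldFbar; letI := T.instAlgebraFbar;
        letI := T.instAlgebraKFbar; letI := T.instIsElliptic;
      ℤ → ∀ v : (thetaIndex (pilotDataOfK T.D T.K)).V, v ∈ (thetaIndex (pilotDataOfK T.D T.K)).Vbad → (logShellsDH (pilotDataOfK T.D T.K) (analyticLogv T.K)).StarPacket v → Module.End ℚ ((logShellsDH (pilotDataOfK T.D T.K) (analyticLogv T.K)).StarPacket v))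
    (Mmod : ∀ (P : NFPoint) (l : ℕ) (T : Cor22.ThetaVolumeDatumAt P l), letI := T.instFieldF; letI := T.instNumberFieldF; letI := T.instAlgebraF; letI := T.instFieldK;
        letI := T.instNumberFieldK; letI := T.instAlgebraK; letI := T.instFieldFbar; letI := T.instAlgebraFbar;
        letI := T.instAlgebraKFbar; letI := T.instIsElliptic;
      ℤ → ∀ j : (thetaIndex (pilotDataOfK T.D T.K)).LabelStar, Set ((logShellsDH (pilotDataOfK T.D T.K) (analyticLogv T.K)).GlobalPacket j.1))
    (region : ∀ (P : NFPoint) (l : ℕ) (T : Cor22.ThetaVolumeDatumAt P l), letI := T.instFieldF; letI := T.instNumberFieldF; letI := T.instAlgebraF; letI := T.instFieldK;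
        letI := T.instNumberFieldK; letI := T.instAlgebraK; letI := T.instFieldFbar; letI := T.instAlgebraFbar;
        letI := T.instAlgebraKFbar; letI := T.instIsElliptic;
      ℤ → ∀ j : (thetaIndex (pilotDataOfK T.D T.K)).LabelStar, FinDivisor (M P l T) → ∀ vQ : (thetaIndex (pilotDataOfK T.D T.K)).VQ, Set ((logShellsDH (pilotDataOfK T.D T.K) (analyticLogv T.K)).Packet j.1 vQ))
    (frobAdm : ∀ (P : NFPoint) (l : ℕ) (T : Cor22.ThetaVolumeDatumAt P l), letI := T.instFieldF; letI := T.instNumberFieldF; letI := T.instAlgebraF; letI := T.instFieldK;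
        letI := T.instNumberFieldK; letI := T.instAlgebraK; letI := T.instFieldFbar; letI := T.instAlgebraFbar;
        letI := T.instAlgebraKFbar; letI := T.instIsElliptic;
      ℤ → ℤ → ∀ (j : (thetaIndex (pilotDataOfK T.D T.K)).Label) (vQ : (thetaIndex (pilotDataOfK T.D T.K)).VQ), Set ((logShellsDH (pilotDataOfK T.D T.K) (analyticLogv T.K)).Packet j vQ) → Prop)
    (frobLogvol : ∀ (P : NFPoint) (l : ℕ) (T : Cor22.ThetaVolumeDatumAt P l), letI := T.instFieldF; letI := T.instNumberFieldF; letI := T.instAlgebraF; letI := T.instFieldK;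
        letI := T.instNumberFieldK; letI := T.instAlgebraK; letI := T.instFieldFbar; letI := T.instAlgebraFbar;
        letI := T.instAlgebraKFbar; letI := T.instIsElliptic;
      ℤ → ℤ → ∀ (j : (thetaIndex (pilotDataOfK T.D T.K)).Label) (vQ : (thetaIndex (pilotDataOfK T.D T.K)).VQ), Set ((logShellsDH (pilotDataOfK T.D T.K) (analyticLogv T.K)).Packet j vQ) → ℝ)
    (frobΨ : ∀ (P : NFPoint) (l : ℕ) (T : Cor22.ThetaVolumeDatumAt P l), letI := T.instFieldF; letI := T.instNumberFieldF; letI := T.instAlgebraF; letI := T.instFieldK;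
        letI := T.instNumberFieldK; letI := T.instAlgebraK; letI := T.instFieldFbar; letI := T.instAlgebraFbar;
        letI := T.instAlgebraKFbar; letI := T.instIsElliptic;
      ℤ → ℤ → ∀ v : (thetaIndex (pilotDataOfK T.D T.K)).V, v ∈ (thetaIndex (pilotDataOfK T.D T.K)).Vbad → Set ((logShellsDH (pilotDataOfK T.D T.K) (analyticLogv T.K)).StarPacket v))
    (frobMmod : ∀ (P : NFPoint) (l : ℕ) (T : Cor22.ThetaVolumeDatumAt P l), letI := T.instFieldF; letI := T.instNumberFieldF; letI := T.instAlgebraF; letI := T.instFieldK;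
        letI := T.instNumberFieldK; letI := T.instAlgebraK; letI := T.instFieldFbar; letI := T.instAlgebraFbar;
        letI := T.instAlgebraKFbar; letI := T.instIsElliptic;
      ℤ → ℤ → ∀ j : (thetaIndex (pilotDataOfK T.D T.K)).LabelStar, Set ((logShellsDH (pilotDataOfK T.D T.K) (analyticLogv T.K)).GlobalPacket j.1))
    (unitImage : ∀ (P : NFPoint) (l : ℕ) (T : Cor22.ThetaVolumeDatumAt P l), letI := T.instFieldF; letI := T.instNumberFieldF; letI := T.instAlgebraF; letI := T.instFieldK;
        letI := T.instNumberFieldK; letI := T.instAlgebraK; letI := T.instFieldFbar; letI := T.instAlgebraFbar;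
        letI := T.instAlgebraKFbar; letI := T.instIsElliptic;
      ℤ → ℤ → ℕ → ∀ (j : (thetaIndex (pilotDataOfK T.D T.K)).Label) (vQ : (thetaIndex (pilotDataOfK T.D T.K)).VQ), Set ((logShellsDH (pilotDataOfK T.D T.K) (analyticLogv T.K)).Packet j vQ))
    (ballImage : ∀ (P : NFPoint) (l : ℕ) (T : Cor22.ThetaVolumeDatumAt P l), letI := T.instFieldF; letI := T.instNumberFieldF; letI := T.instAlgebraF; letI := T.instFieldK;
        letI := T.instNumberFieldK; letI := T.instAlgebraK; letI := T.instFieldFbar; letI := T.instAlgebraFbar;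
        letI := T.instAlgebraKFbar; letI := T.instIsElliptic;
      ℤ → ℤ → ∀ (j : (thetaIndex (pilotDataOfK T.D T.K)).Label) (vQ : (thetaIndex (pilotDataOfK T.D T.K)).VQ), Set ((logShellsDH (pilotDataOfK T.D T.K) (analyticLogv T.K)).Packet j vQ))
    (thetaDiv : ∀ (P : NFPoint) (l : ℕ) (T : Cor22.ThetaVolumeDatumAt P l), letI := T.instFieldF; letI := T.instNumberFieldF; letI := T.instAlgebraF; letI := T.instFieldK;
        letI := T.instNumberFieldK; letI := T.instAlgebraK; letI := T.instFieldFbar; letI := T.instAlgebraFbar;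
        letI := T.instAlgebraKFbar; letI := T.instIsElliptic;
      ℤ → ℤ → LgpDivisor (M P l T) (thetaIndex (pilotDataOfK T.D T.K)).lstar)
    (n : ∀ (P : NFPoint) (l : ℕ) (T : Cor22.ThetaVolumeDatumAt P l), ℤ)
    {HT : ∀ (P : NFPoint) (l : ℕ) (T : Cor22.ThetaVolumeDatumAt P l), Type} {LogLink : ∀ (P : NFPoint) (l : ℕ) (T : Cor22.ThetaVolumeDatumAt P l), HT P l T → HT P l T → Type}
    {IsFull : ∀ (P : NFPoint) (l : ℕ) (T : Cor22.ThetaVolumeDatumAt P l), ∀ {s t : HT P l T}, LogLink P l T s t → Prop}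
    (lat : ∀ (P : NFPoint) (l : ℕ) (T : Cor22.ThetaVolumeDatumAt P l), LGPGaussianLogThetaLattice (LogLink P l T) (IsFull P l T))
    {Frd : ∀ (P : NFPoint) (l : ℕ) (T : Cor22.ThetaVolumeDatumAt P l), Type} {IsoF : ∀ (P : NFPoint) (l : ℕ) (T : Cor22.ThetaVolumeDatumAt P l), Frd P l T → Frd P l T → Type} {Ob : ∀ (P : NFPoint) (l : ℕ) (T : Cor22.ThetaVolumeDatumAt P l), Frd P l T → Type}
    {realify : ∀ (P : NFPoint) (l : ℕ) (T : Cor22.ThetaVolumeDatumAt P l), Frd P l T → Frd P l T} {Strip : ∀ (P : NFPoint) (l : ℕ) (T : Cor22.ThetaVolumeDatumAt P l), Type} {IsoS : ∀ (P : NFPoint) (l : ℕ) (T : Cor22.ThetaVolumeDatumAt P l), Strip P l T → Strip P l T → Type}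
    {Mv : ∀ (P : NFPoint) (l : ℕ) (T : Cor22.ThetaVolumeDatumAt P l), letI := T.instFieldF; letI := T.instNumberFieldF; letI := T.instAlgebraF; letI := T.instFieldK;
        letI := T.instNumberFieldK; letI := T.instAlgebraK; letI := T.instFieldFbar; letI := T.instAlgebraFbar;
        letI := T.instAlgebraKFbar; letI := T.instIsElliptic;
      ∀ v : (thetaIndex (pilotDataOfK T.D T.K)).V, v ∈ (thetaIndex (pilotDataOfK T.D T.K)).Vbad → Type}
    [∀ P l T v h, Monoid (Mv P l T v h)]
    (sig : ∀ (P : NFPoint) (l : ℕ) (T : Cor22.ThetaVolumeDatumAt P l), letI := T.instFieldF; letI := T.instNumberFieldF; letI := T.instAlgebraF; letI := T.instFieldK;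
        letI := T.instNumberFieldK; letI := T.instAlgebraK; letI := T.instFieldFbar; letI := T.instAlgebraFbar;
        letI := T.instAlgebraKFbar; letI := T.instIsElliptic;
      GlobalLGPFrobenioidSignature (thetaIndex (pilotDataOfK T.D T.K)).lstar (thetaIndex (pilotDataOfK T.D T.K)).V (· ∈ (thetaIndex (pilotDataOfK T.D T.K)).Vbad) (Frd P l T) (IsoF P l T) (Ob P l T) (realify P l T)
        (Strip P l T) (IsoS P l T) (Mv P l T))
    (split : ∀ (P : NFPoint) (l : ℕ) (T : Cor22.ThetaVolumeDatumAt P l), SplittingMonoids (Mv P l T))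
    {ObΔ : ∀ (P : NFPoint) (l : ℕ) (T : Cor22.ThetaVolumeDatumAt P l), Type} {N : ∀ (P : NFPoint) (l : ℕ) (T : Cor22.ThetaVolumeDatumAt P l), letI := T.instFieldF; letI := T.instNumberFieldF; letI := T.instAlgebraF; letI := T.instFieldK;
        letI := T.instNumberFieldK; letI := T.instAlgebraK; letI := T.instFieldFbar; letI := T.instAlgebraFbar;
        letI := T.instAlgebraKFbar; letI := T.instIsElliptic;
      ∀ v : (thetaIndex (pilotDataOfK T.D T.K)).V, v ∈ (thetaIndex (pilotDataOfK T.D T.K)).Vbad → Type}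
    [∀ P l T v h, Monoid (N P l T v h)] (qData : ∀ (P : NFPoint) (l : ℕ) (T : Cor22.ThetaVolumeDatumAt P l), QPilotData (ObΔ P l T) (N P l T))
    (qK : ∀ (P : NFPoint) (l : ℕ) (T : Cor22.ThetaVolumeDatumAt P l), letI := T.instFieldF; letI := T.instNumberFieldF; letI := T.instAlgebraF; letI := T.instFieldK;
        letI := T.instNumberFieldK; letI := T.instAlgebraK; letI := T.instFieldFbar; letI := T.instAlgebraFbar;
        letI := T.instAlgebraKFbar; letI := T.instIsElliptic;
      ∀ v : (thetaIndex (pilotDataOfK T.D T.K)).V, v ∈ (thetaIndex (pilotDataOfK T.D T.K)).Vbad → Set ((logShellsDH (pilotDataOfK T.D T.K) (analyticLogv T.K)).StarPacket v))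

include M archPk archSub Ψ act Mmod region frobAdm frobLogvol frobΨ frobMmod unitImage ballImage thetaDiv n lat sig split qData qK

/-! ## §1. The two generic re-cut certificates for an arbitrary datum class `InSig` with a kernel door -/

/-- **`abc_of_inSigma_orNum_K_szpiroBad_hregBad` — «S|Σ ⟹ abc» with the complement of Σ PRICED: explicit 2 = NUM-OFF-Σ(Szpiro-bad) · CONE(Szpiro-bad).**
abc-iut-C-cert-2's stable companion `Conditional.abc_of_SH_orNum_K_szpiroBad_hregBad` (p452637) with its per-datum binder `hNumOffBad` («at Szpiro-bad
admissible `(P, l)`, wherever OUR typed (xi-f) licence FAILS at the chosen ideles / pinned reading, `T.Cor312Of`») DISCHARGED ON Σ: a datum class `InSig`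
with its DOOR `hdoor` («`InSig T` ⟹ the licence at `T`'s bed» — the landed doors of rows 15 / 8 / 18 / 16) makes the licence a theorem on Σ, so only
«Szpiro-bad ∧ admissible ∧ `T ∉ Σ` ⟹ `T.Cor312Of`» (`hNumOffSigmaBad`) and `hregBad` (p452637 VERBATIM) remain. No binder is kernel-refuted
(contrast `Conditional.not_hreg_v4` for the blanket `hreg`). «`ABC` follows from these hypotheses AS TYPED», nothing more; no side taken on [IUTchIII]
Cor. 3.12; typed ≠ proved; instantiated ≠ endorsed. [claim: Mochizuki2012, status: disputed]
[cite: Mochizuki2012, IUTchIII Cor. 3.12 p. 173–174, Step (xi-f) p. 184; IUTchIV Thm. 1.10 Step (viii) p. 30] [cite: DupuyHilado2025, §3.9, §4.9] -/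
theorem abc_of_inSigma_orNum_K_szpiroBad_hregBad
    -- an ARBITRARY datum class `InSig` with its DOOR to the hull clause at the certificates' bed
    (InSig : ∀ (P : NFPoint) (l : ℕ), Cor22.ThetaVolumeDatumAt P l → Prop)
    (hdoor : ∀ (P : NFPoint) (l : ℕ) (T : Cor22.ThetaVolumeDatumAt P l), letI := T.instFieldF; letI := T.instNumberFieldF; letI := T.instAlgebraF; letI := T.instFieldK;
        letI := T.instNumberFieldK; letI := T.instAlgebraK; letI := T.instFieldFbar; letI := T.instAlgebraFbar;
        letI := T.instAlgebraKFbar; letI := T.instIsElliptic;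
      InSig P l T →
      Cor312Vol.PilotKummerCompatHull
        (LatticeSituation.ofShells (logShellsDH (pilotDataOfK T.D T.K) (analyticLogv T.K)) (M P l T) (archPk P l T)
          (archSub P l T) (summandPiecesPr (pilotDataOfK T.D T.K) (logvAnalytic_analyticLogv (F := T.K))).Adm
          (summandPiecesPr (pilotDataOfK T.D T.K) (logvAnalytic_analyticLogv (F := T.K))).logvol (Ψ P l T) (act P l T) (Mmod P l T)
          (region P l T) (frobAdm P l T) (frobLogvol P l T) (frobΨ P l T) (frobMmod P l T) (unitImage P l T)
          (ballImage P l T) (thetaDiv P l T))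
        (settingPrVolSharp (pilotDataOfK T.D T.K) (logvAnalytic_analyticLogv (F := T.K)) (M P l T) (archPk P l T) (archSub P l T) (Ψ P l T)
          (act P l T) (Mmod P l T) (region P l T) (n P l T) (lat P l T) (sig P l T) (split P l T) (qData P l T)
          (exists_realising_qIdeles_pilotDataOfK T.D).choose
          (exists_realising_thetaIdeles_pilotDataOfK T.D).choose
          (exists_realising_qIdeles_pilotDataOfK T.D).choose_spec.1
          (exists_realising_qIdeles_pilotDataOfK T.D).choose_spec.2.1)
        (fun _ => Cor312.Setting.qRegion
        (settingPrVolSharp (pilotDataOfK T.D T.K) (logvAnalytic_analyticLogv (F := T.K)) (M P l T) (archPk P l T) (archSub P l T) (Ψ P l T)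
          (act P l T) (Mmod P l T) (region P l T) (n P l T) (lat P l T) (sig P l T) (split P l T) (qData P l T)
          (exists_realising_qIdeles_pilotDataOfK T.D).choose
          (exists_realising_thetaIdeles_pilotDataOfK T.D).choose
          (exists_realising_qIdeles_pilotDataOfK T.D).choose_spec.1
          (exists_realising_qIdeles_pilotDataOfK T.D).choose_spec.2.1)) (qK P l T))
    -- [NUM, OFF Σ ∧ SZPIRO-BAD] the NUMBER-level Corollary 3.12 at every genuine datum OUTSIDE the class, ONLY at SZPIRO-BAD admissible points
    (hNumOffSigmaBad : ∀ (P : NFPoint), P ∈ UP → ∀ (l : ℕ), l.Prime → 5 ≤ l →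
      Cor22.AdmitsCore P → Cor22.CondP2 P l → Cor22.CondP5 P l → Cor22.CondP6 P l →
      -- ONLY at SZPIRO-BAD `(P, l)`: elsewhere `T.Cor312Of` is the theorem `Cor22.ThetaVolumeDatumAt.cor312Of_of_szpiro` (abc-iut-c312-d1)
      (((l : ℝ) + 5) / 4 < (Cor22.dmod P : ℝ) ∨
        6 * l * (((l : ℝ) + 5) - 4 * Cor22.dmod P) / (((l : ℝ) + 4) * ((l : ℝ) - 3))
            * (P.logDiff + (1 - 1 / (l : ℝ)) * Cor22.logCondAvoid P {2, l})
          + 6 * l * ((l : ℝ) + 5) / (((l : ℝ) + 4) * ((l : ℝ) - 3)) * Real.log Real.pi < Cor22.logQAvoid P {2, l}) →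
      ∀ (T : Cor22.ThetaVolumeDatumAt P l), ¬ InSig P l T → T.Cor312Of)
    -- [CONE, SZPIRO-BAD] the hull estimate with print's `B_III(P,l)` off the slot-constant regime, ONLY at SZPIRO-BAD admissible points (C-R28 (3)(α))
    (hregBad : ∀ P : NFPoint, P ∈ UP → ∀ l : ℕ, l.Prime → 5 ≤ l →
      Cor22.AdmitsCore P → Cor22.CondP2 P l → Cor22.CondP5 P l → Cor22.CondP6 P l →
      (((l : ℝ) + 5) / 4 < (Cor22.dmod P : ℝ) ∨
        6 * l * (((l : ℝ) + 5) - 4 * Cor22.dmod P) / (((l : ℝ) + 4) * ((l : ℝ) - 3))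
            * (P.logDiff + (1 - 1 / (l : ℝ)) * Cor22.logCondAvoid P {2, l})
          + 6 * l * ((l : ℝ) + 5) / (((l : ℝ) + 4) * ((l : ℝ) - 3)) * Real.log Real.pi < Cor22.logQAvoid P {2, l}) →
      ∀ T : Cor22.ThetaVolumeDatumAt P l,
        (letI := T.instFieldF; letI := T.instNumberFieldF; letI := T.instAlgebraF; letI := T.instFieldK
         letI := T.instNumberFieldK; letI := T.instAlgebraK; letI := T.instFieldFbar; letI := T.instAlgebraFbar
         letI := T.instAlgebraKFbar; letI := T.instIsElliptic
         ¬ (∀ p ∈ T.I.supportPrimes, ∀ v w : placesOver (fieldOfModuli T.E) p,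
            (Summit.ABC.IUTFork.DHData.ofInput T.I).logQloc p v = (Summit.ABC.IUTFork.DHData.ofInput T.I).logQloc p w)) →
        T.HullEstimateOf
          (((l : ℝ) + 1) / 4 *
            ((1 + 12 * (Cor22.dmod P : ℝ) / l) * (P.logDiff + Cor22.logCondAvoid P {2, l})
              + 2 * Real.log l + 52
              + 20 / 3 * Real.log (((2 ^ 12 * 3 ^ 3 * 5 * Cor22.dmod P : ℕ) : ℝ) * (l : ℝ))
                * (Nat.primeCounting (2 ^ 12 * 3 ^ 3 * 5 * Cor22.dmod P * l) : ℝ))))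
    : _root_.ABC :=
  Conditional.abc_of_SH_orNum_K_szpiroBad_hregBad (M := M) (archPk := archPk) (archSub := archSub) (Ψ := Ψ) (act := act) (Mmod := Mmod)
    (region := region) (frobAdm := frobAdm) (frobLogvol := frobLogvol) (frobΨ := frobΨ) (frobMmod := frobMmod) (unitImage := unitImage)
    (ballImage := ballImage) (thetaDiv := thetaDiv) (n := n) (lat := lat) (sig := sig) (split := split) (qData := qData) (qK := qK)
    (hregBad := hregBad)
    (hNumOffBad := fun P hP l hl h5 hc h2 h5' h6 hbad T hS =>
      hNumOffSigmaBad P hP l hl h5 hc h2 h5' h6 hbad T fun hIn => hS (hdoor P l T hIn))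

/-- **`abc_of_inSigma_v10K_window_szpiroBadAll` — «S|Σ ⟹ abc» in the TRIPLE-CUT shape of record (p453137), for an ARBITRARY datum class with a door.**
abc-iut-s2-p2's `Conditional.abc_of_SH_v10K_window_szpiroBadAll` (explicit 3 = S_H(window ∧ Szpiro-bad) · NUM(deep ∧ Szpiro-bad) · CONE(Szpiro-bad)) with
`hSHwBad` REPLACED by a datum class `InSig` + its DOOR `hdoor` + the stratum binder `hSigmaBad` («every admissible datum off the depth locus OF A
SZPIRO-BAD POINT lies in `InSig`»); `hNumBad`, `hregBad` VERBATIM from p453137. = this seat's p471933 `abc_of_inSigma_v10K_window_szpiroBadBoth` with the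
kernel-refuted `hreg` replaced by `hregBad` — NOTHING else changed; no binder here is kernel-refuted. «`ABC` follows from these hypotheses AS TYPED»,
nothing more; no side taken on [IUTchIII] Cor. 3.12; typed ≠ proved; instantiated ≠ endorsed. [claim: Mochizuki2012, status: disputed]
[cite: Mochizuki2012, IUTchIII Cor. 3.12 p. 173–174, Step (xi-f) p. 184; IUTchIV Thm. 1.10 p. 22–23] [cite: DupuyHilado2025, §3.9, §4.9]
**WARNING (abc-iut-rh2-q2-hull gen 3, after referee abc-iut-rp-m1's kernel caveat of 2026-08-27 and the landing of (P6) at the tier-1 Frey–Legendre datum,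
`Conditional.condP6_thirteen`): VACUOUS AS TYPED FOR EVERY DOORED CLASS THAT MISSES THE FREY DATA.** Whenever no genuine datum over `(ratPoint λ₃₆₇₇, 13)` lies in
`InSig` — the case of ALL this seat's doored classes Σ₁₅ / Σ₈ / Σ₁₈ / Σ₁₆ (`RH2SigmaHull.frey13_not_inSigma15` & co., `Repair/RH2SigmaHullSigmaBinderRefute.lean`) —
the binder `hSigmaBad` below is KERNEL-FALSE (`RH2SigmaHull.not_hSigmaBad_of_forall_not_frey13`, no hypothesis), so this implication, though kernel-true, can never
be discharged there. Successor shape: `abc_of_inSigma_orNum_K_szpiroBad_hregBad` above (explicit 2); kept here as a record. -/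
theorem abc_of_inSigma_v10K_window_szpiroBadAll
    -- an ARBITRARY datum class `InSig` with its DOOR to the hull clause at the certificates' bed
    (InSig : ∀ (P : NFPoint) (l : ℕ), Cor22.ThetaVolumeDatumAt P l → Prop)
    (hdoor : ∀ (P : NFPoint) (l : ℕ) (T : Cor22.ThetaVolumeDatumAt P l), letI := T.instFieldF; letI := T.instNumberFieldF; letI := T.instAlgebraF; letI := T.instFieldK;
        letI := T.instNumberFieldK; letI := T.instAlgebraK; letI := T.instFieldFbar; letI := T.instAlgebraFbar;
        letI := T.instAlgebraKFbar; letI := T.instIsElliptic;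
      InSig P l T →
      Cor312Vol.PilotKummerCompatHull
        (LatticeSituation.ofShells (logShellsDH (pilotDataOfK T.D T.K) (analyticLogv T.K)) (M P l T) (archPk P l T)
          (archSub P l T) (summandPiecesPr (pilotDataOfK T.D T.K) (logvAnalytic_analyticLogv (F := T.K))).Adm
          (summandPiecesPr (pilotDataOfK T.D T.K) (logvAnalytic_analyticLogv (F := T.K))).logvol (Ψ P l T) (act P l T) (Mmod P l T)
          (region P l T) (frobAdm P l T) (frobLogvol P l T) (frobΨ P l T) (frobMmod P l T) (unitImage P l T)
          (ballImage P l T) (thetaDiv P l T))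
        (settingPrVolSharp (pilotDataOfK T.D T.K) (logvAnalytic_analyticLogv (F := T.K)) (M P l T) (archPk P l T) (archSub P l T) (Ψ P l T)
          (act P l T) (Mmod P l T) (region P l T) (n P l T) (lat P l T) (sig P l T) (split P l T) (qData P l T)
          (exists_realising_qIdeles_pilotDataOfK T.D).choose
          (exists_realising_thetaIdeles_pilotDataOfK T.D).choose
          (exists_realising_qIdeles_pilotDataOfK T.D).choose_spec.1
          (exists_realising_qIdeles_pilotDataOfK T.D).choose_spec.2.1)
        (fun _ => Cor312.Setting.qRegion
        (settingPrVolSharp (pilotDataOfK T.D T.K) (logvAnalytic_analyticLogv (F := T.K)) (M P l T) (archPk P l T) (archSub P l T) (Ψ P l T)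
          (act P l T) (Mmod P l T) (region P l T) (n P l T) (lat P l T) (sig P l T) (split P l T) (qData P l T)
          (exists_realising_qIdeles_pilotDataOfK T.D).choose
          (exists_realising_thetaIdeles_pilotDataOfK T.D).choose
          (exists_realising_qIdeles_pilotDataOfK T.D).choose_spec.1
          (exists_realising_qIdeles_pilotDataOfK T.D).choose_spec.2.1)) (qK P l T))
    -- [Σ, WINDOW ∧ SZPIRO-BAD] every admissible datum OFF the depth locus of a SZPIRO-BAD point lies in the class `InSig`
    (hSigmaBad : ∀ (P : NFPoint), P ∈ UP → ∀ (l : ℕ), l.Prime → 5 ≤ l →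
      Cor22.AdmitsCore P → Cor22.CondP2 P l → Cor22.CondP5 P l → Cor22.CondP6 P l →
      -- ONLY at SZPIRO-BAD `(P, l)`: elsewhere `T.Cor312Of` is the theorem `Cor22.ThetaVolumeDatumAt.cor312Of_of_szpiro` (abc-iut-c312-d1)
      (((l : ℝ) + 5) / 4 < (Cor22.dmod P : ℝ) ∨
        6 * l * (((l : ℝ) + 5) - 4 * Cor22.dmod P) / (((l : ℝ) + 4) * ((l : ℝ) - 3))
            * (P.logDiff + (1 - 1 / (l : ℝ)) * Cor22.logCondAvoid P {2, l})
          + 6 * l * ((l : ℝ) + 5) / (((l : ℝ) + 4) * ((l : ℝ) - 3)) * Real.log Real.pi < Cor22.logQAvoid P {2, l}) →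
      ∀ (T : Cor22.ThetaVolumeDatumAt P l), letI := T.instFieldF; letI := T.instNumberFieldF; letI := T.instAlgebraF; letI := T.instFieldK;
        letI := T.instNumberFieldK; letI := T.instAlgebraK; letI := T.instFieldFbar; letI := T.instAlgebraFbar;
        letI := T.instAlgebraKFbar; letI := T.instIsElliptic;
      ¬ (∃ (pp : Nat.Primes) (_ : 2 < (pp : ℕ)) (i : Fin (thetaIndex (pilotDataOfK T.D T.K)).lstar)
          (x₀ : (thetaIndex (pilotDataOfK T.D T.K)).Fibre (.inr pp)),
        haveI : Fact (pp : ℕ).Prime := ⟨pp.2⟩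
        ((pp : ℕ) : ℝ) ^ ((((i : ℕ) : ℝ) + 2) * (4 + 2 * Real.logb (pp : ℕ) (Module.finrank ℚ T.K)) + 1) *
          ‖(exists_realising_qIdeles_pilotDataOfK T.D).choose pp x₀‖ ^ (((i : ℕ) + 1) ^ 2 - 1) < 1) →
      InSig P l T)
    -- [NUM, DEEP ∧ SZPIRO-BAD] the NUMBER-level Corollary 3.12, ONLY at admissible data ON the depth locus of SZPIRO-BAD points
    (hNumBad : ∀ (P : NFPoint), P ∈ UP → ∀ (l : ℕ), l.Prime → 5 ≤ l →
      Cor22.AdmitsCore P → Cor22.CondP2 P l → Cor22.CondP5 P l → Cor22.CondP6 P l →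
      -- ONLY at SZPIRO-BAD `(P, l)`: elsewhere `T.Cor312Of` is the theorem `Cor22.ThetaVolumeDatumAt.cor312Of_of_szpiro` (abc-iut-c312-d1)
      (((l : ℝ) + 5) / 4 < (Cor22.dmod P : ℝ) ∨
        6 * l * (((l : ℝ) + 5) - 4 * Cor22.dmod P) / (((l : ℝ) + 4) * ((l : ℝ) - 3))
            * (P.logDiff + (1 - 1 / (l : ℝ)) * Cor22.logCondAvoid P {2, l})
          + 6 * l * ((l : ℝ) + 5) / (((l : ℝ) + 4) * ((l : ℝ) - 3)) * Real.log Real.pi < Cor22.logQAvoid P {2, l}) →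
      ∀ (T : Cor22.ThetaVolumeDatumAt P l), letI := T.instFieldF; letI := T.instNumberFieldF; letI := T.instAlgebraF; letI := T.instFieldK;
        letI := T.instNumberFieldK; letI := T.instAlgebraK; letI := T.instFieldFbar; letI := T.instAlgebraFbar;
        letI := T.instAlgebraKFbar; letI := T.instIsElliptic;
      (∃ (pp : Nat.Primes) (_ : 2 < (pp : ℕ)) (i : Fin (thetaIndex (pilotDataOfK T.D T.K)).lstar)
          (x₀ : (thetaIndex (pilotDataOfK T.D T.K)).Fibre (.inr pp)),
        haveI : Fact (pp : ℕ).Prime := ⟨pp.2⟩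
        ((pp : ℕ) : ℝ) ^ ((((i : ℕ) : ℝ) + 2) * (4 + 2 * Real.logb (pp : ℕ) (Module.finrank ℚ T.K)) + 1) *
          ‖(exists_realising_qIdeles_pilotDataOfK T.D).choose pp x₀‖ ^ (((i : ℕ) + 1) ^ 2 - 1) < 1) → T.Cor312Of)
    -- [CONE, SZPIRO-BAD] the hull estimate with print's `B_III(P,l)` off the slot-constant regime, ONLY at SZPIRO-BAD admissible points (C-R28 (3)(α))
    (hregBad : ∀ P : NFPoint, P ∈ UP → ∀ l : ℕ, l.Prime → 5 ≤ l →
      Cor22.AdmitsCore P → Cor22.CondP2 P l → Cor22.CondP5 P l → Cor22.CondP6 P l →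
      (((l : ℝ) + 5) / 4 < (Cor22.dmod P : ℝ) ∨
        6 * l * (((l : ℝ) + 5) - 4 * Cor22.dmod P) / (((l : ℝ) + 4) * ((l : ℝ) - 3))
            * (P.logDiff + (1 - 1 / (l : ℝ)) * Cor22.logCondAvoid P {2, l})
          + 6 * l * ((l : ℝ) + 5) / (((l : ℝ) + 4) * ((l : ℝ) - 3)) * Real.log Real.pi < Cor22.logQAvoid P {2, l}) →
      ∀ T : Cor22.ThetaVolumeDatumAt P l,
        (letI := T.instFieldF; letI := T.instNumberFieldF; letI := T.instAlgebraF; letI := T.instFieldK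
         letI := T.instNumberFieldK; letI := T.instAlgebraK; letI := T.instFieldFbar; letI := T.instAlgebraFbar
         letI := T.instAlgebraKFbar; letI := T.instIsElliptic
         ¬ (∀ p ∈ T.I.supportPrimes, ∀ v w : placesOver (fieldOfModuli T.E) p,
            (Summit.ABC.IUTFork.DHData.ofInput T.I).logQloc p v = (Summit.ABC.IUTFork.DHData.ofInput T.I).logQloc p w)) →
        T.HullEstimateOf
          (((l : ℝ) + 1) / 4 *
            ((1 + 12 * (Cor22.dmod P : ℝ) / l) * (P.logDiff + Cor22.logCondAvoid P {2, l})
              + 2 * Real.log l + 52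
              + 20 / 3 * Real.log (((2 ^ 12 * 3 ^ 3 * 5 * Cor22.dmod P : ℕ) : ℝ) * (l : ℝ))
                * (Nat.primeCounting (2 ^ 12 * 3 ^ 3 * 5 * Cor22.dmod P * l) : ℝ))))
    : _root_.ABC :=
  Conditional.abc_of_SH_v10K_window_szpiroBadAll (M := M) (archPk := archPk) (archSub := archSub) (Ψ := Ψ) (act := act) (Mmod := Mmod)
    (region := region) (frobAdm := frobAdm) (frobLogvol := frobLogvol) (frobΨ := frobΨ) (frobMmod := frobMmod) (unitImage := unitImage)
    (ballImage := ballImage) (thetaDiv := thetaDiv) (n := n) (lat := lat) (sig := sig) (split := split) (qData := qData) (qK := qK)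
    (hNumBad := hNumBad) (hregBad := hregBad)
    (hSHwBad := fun P hP l hl h5 hc h2 h5' h6 hbad T hT => hdoor P l T (hSigmaBad P hP l hl h5 hc h2 h5' h6 hbad T hT))

/-! ## §2. The row-15 instance (rows 8, 18, 16: companion `Repair/RH2SigmaHullRecutRows.lean`) -/

/-- **`abc_of_sigma15_v10K_window_szpiroBadAll` — row 15 (slot-reach window Σ₁₅), re-cut.** §1 at `InSig := «∃ certified (n₀, λ, m_q) with
SlotReachWindowK T.D ramIdx n₀ λ (j²·m_q) m_q»`, door `pilotKummerCompatHull_chosen_of_slotReachWindowK` (p469830). Binder texts = p471933's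
`abc_of_sigma15_v10K_window_szpiroBadBoth` except `hreg ↦ hregBad`; explicit 3 = Σ₁₅(window ∧ bad) · NUM(deep ∧ bad) · CONE(bad); no binder kernel-refuted.
Whether shallow Szpiro-bad admissible data lie in Σ₁₅ is Q3, not claimed. «`ABC` follows from these hypotheses AS TYPED»; no side taken on [IUTchIII]
Cor. 3.12; typed ≠ proved. [claim: Mochizuki2012, status: disputed] [cite: DupuyHilado2025, §3.9, §4.9]
**WARNING (abc-iut-rh2-q2-hull gen 3, after referee abc-iut-rp-m1's kernel caveat of 2026-08-27): VACUOUS AS TYPED.** The binder `hSigma15Bad` below is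
KERNEL-FALSE — `RH2SigmaHull.not_hSigma15Bad` (`Repair/RH2SigmaHullSigmaBinderRefute.lean`; every genuine datum over the admissible Szpiro-bad tier-1
Frey–Legendre point `(ratPoint λ₃₆₇₇, 13)` is shallow and OFF Σ₁₅, unconditionally since `Conditional.condP6_thirteen`) — so this implication, though kernel-true,
can never be discharged. Successor shape: `abc_of_inSigma_orNum_K_szpiroBad_hregBad` (explicit 2 = NUM-OFF-Σ(Szpiro-bad) · CONE(Szpiro-bad)); kept as a record. -/
theorem abc_of_sigma15_v10K_window_szpiroBadAll
    -- [Σ₁₅, WINDOW ∧ SZPIRO-BAD] a certified slot-reach dictionary at every admissible datum off the depth locus of a Szpiro-bad point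
    (hSigma15Bad : ∀ (P : NFPoint), P ∈ UP → ∀ (l : ℕ), l.Prime → 5 ≤ l →
      Cor22.AdmitsCore P → Cor22.CondP2 P l → Cor22.CondP5 P l → Cor22.CondP6 P l →
      -- ONLY at SZPIRO-BAD `(P, l)`: elsewhere `T.Cor312Of` is the theorem `Cor22.ThetaVolumeDatumAt.cor312Of_of_szpiro` (abc-iut-c312-d1)
      (((l : ℝ) + 5) / 4 < (Cor22.dmod P : ℝ) ∨
        6 * l * (((l : ℝ) + 5) - 4 * Cor22.dmod P) / (((l : ℝ) + 4) * ((l : ℝ) - 3))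
            * (P.logDiff + (1 - 1 / (l : ℝ)) * Cor22.logCondAvoid P {2, l})
          + 6 * l * ((l : ℝ) + 5) / (((l : ℝ) + 4) * ((l : ℝ) - 3)) * Real.log Real.pi < Cor22.logQAvoid P {2, l}) →
      ∀ (T : Cor22.ThetaVolumeDatumAt P l), letI := T.instFieldF; letI := T.instNumberFieldF; letI := T.instAlgebraF; letI := T.instFieldK;
        letI := T.instNumberFieldK; letI := T.instAlgebraK; letI := T.instFieldFbar; letI := T.instAlgebraFbar;
        letI := T.instAlgebraKFbar; letI := T.instIsElliptic;
      ¬ (∃ (pp : Nat.Primes) (_ : 2 < (pp : ℕ)) (i : Fin (thetaIndex (pilotDataOfK T.D T.K)).lstar)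
          (x₀ : (thetaIndex (pilotDataOfK T.D T.K)).Fibre (.inr pp)),
        haveI : Fact (pp : ℕ).Prime := ⟨pp.2⟩
        ((pp : ℕ) : ℝ) ^ ((((i : ℕ) : ℝ) + 2) * (4 + 2 * Real.logb (pp : ℕ) (Module.finrank ℚ T.K)) + 1) *
          ‖(exists_realising_qIdeles_pilotDataOfK T.D).choose pp x₀‖ ^ (((i : ℕ) + 1) ^ 2 - 1) < 1) →
      ∃ (n₀ : ∀ pp : Nat.Primes, (thetaIndex (pilotDataOfK T.D T.K)).Fibre (.inr pp) → ℕ)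
        (lam : ∀ pp : Nat.Primes, (thetaIndex (pilotDataOfK T.D T.K)).Fibre (.inr pp) → ℝ)
        (mq : ∀ pp : Nat.Primes, (thetaIndex (pilotDataOfK T.D T.K)).Fibre (.inr pp) → ℤ),
        (∀ (pp : Nat.Primes) (x : (thetaIndex (pilotDataOfK T.D T.K)).Fibre (.inr pp)), haveI : Fact (pp : ℕ).Prime := ⟨pp.2⟩;
          ∃ u : kOf (pilotDataOfK T.D T.K) pp.1 x,
            ‖u‖ ≤ (pp : ℝ) ^ (-(((n₀ pp x : ℤ) - 1 : ℤ) : ℝ) / (ramIdx T.K (placeOf (pilotDataOfK T.D T.K) pp.1 x) : ℝ)) ∧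
              u ∉ (logUnits (kOf (pilotDataOfK T.D T.K) pp.1 x) : Set (kOf (pilotDataOfK T.D T.K) pp.1 x))) ∧
        (∀ (pp : Nat.Primes) (x : (thetaIndex (pilotDataOfK T.D T.K)).Fibre (.inr pp)), haveI : Fact (pp : ℕ).Prime := ⟨pp.2⟩;
          ∃ z ∈ (logUnits (kOf (pilotDataOfK T.D T.K) pp.1 x) : Set (kOf (pilotDataOfK T.D T.K) pp.1 x)), (pp : ℝ) ^ (lam pp x) ≤ ‖z‖) ∧
        (∀ (pp : Nat.Primes) (w : (thetaIndex (pilotDataOfK T.D T.K)).Fibre (.inr pp)), haveI : Fact (pp : ℕ).Prime := ⟨pp.2⟩;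
          placeOf (pilotDataOfK T.D T.K) pp.1 w ∈ (pilotDataOfK T.D T.K).S →
            (mq pp w : ℝ) = (pilotDataOfK T.D T.K).qPilot (placeOf (pilotDataOfK T.D T.K) pp.1 w)) ∧
        SlotReachWindowK T.D
          (fun pp x => haveI : Fact (pp : ℕ).Prime := ⟨pp.2⟩; ramIdx T.K (placeOf (pilotDataOfK T.D T.K) pp.1 x)) n₀ lam
          (fun pp i w => ((((i : ℕ) : ℤ) + 1) ^ 2) * mq pp w) mq)
    (hNumBad : ∀ (P : NFPoint), P ∈ UP → ∀ (l : ℕ), l.Prime → 5 ≤ l →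
      Cor22.AdmitsCore P → Cor22.CondP2 P l → Cor22.CondP5 P l → Cor22.CondP6 P l →
      -- ONLY at SZPIRO-BAD `(P, l)`: elsewhere `T.Cor312Of` is the theorem `Cor22.ThetaVolumeDatumAt.cor312Of_of_szpiro` (abc-iut-c312-d1)
      (((l : ℝ) + 5) / 4 < (Cor22.dmod P : ℝ) ∨
        6 * l * (((l : ℝ) + 5) - 4 * Cor22.dmod P) / (((l : ℝ) + 4) * ((l : ℝ) - 3))
            * (P.logDiff + (1 - 1 / (l : ℝ)) * Cor22.logCondAvoid P {2, l})
          + 6 * l * ((l : ℝ) + 5) / (((l : ℝ) + 4) * ((l : ℝ) - 3)) * Real.log Real.pi < Cor22.logQAvoid P {2, l}) →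
      ∀ (T : Cor22.ThetaVolumeDatumAt P l), letI := T.instFieldF; letI := T.instNumberFieldF; letI := T.instAlgebraF; letI := T.instFieldK;
        letI := T.instNumberFieldK; letI := T.instAlgebraK; letI := T.instFieldFbar; letI := T.instAlgebraFbar;
        letI := T.instAlgebraKFbar; letI := T.instIsElliptic;
      (∃ (pp : Nat.Primes) (_ : 2 < (pp : ℕ)) (i : Fin (thetaIndex (pilotDataOfK T.D T.K)).lstar)
          (x₀ : (thetaIndex (pilotDataOfK T.D T.K)).Fibre (.inr pp)),
        haveI : Fact (pp : ℕ).Prime := ⟨pp.2⟩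
        ((pp : ℕ) : ℝ) ^ ((((i : ℕ) : ℝ) + 2) * (4 + 2 * Real.logb (pp : ℕ) (Module.finrank ℚ T.K)) + 1) *
          ‖(exists_realising_qIdeles_pilotDataOfK T.D).choose pp x₀‖ ^ (((i : ℕ) + 1) ^ 2 - 1) < 1) → T.Cor312Of)
    -- [CONE, SZPIRO-BAD] the hull estimate with print's `B_III(P,l)` off the slot-constant regime, ONLY at SZPIRO-BAD admissible points (C-R28 (3)(α))
    (hregBad : ∀ P : NFPoint, P ∈ UP → ∀ l : ℕ, l.Prime → 5 ≤ l →
      Cor22.AdmitsCore P → Cor22.CondP2 P l → Cor22.CondP5 P l → Cor22.CondP6 P l →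
      (((l : ℝ) + 5) / 4 < (Cor22.dmod P : ℝ) ∨
        6 * l * (((l : ℝ) + 5) - 4 * Cor22.dmod P) / (((l : ℝ) + 4) * ((l : ℝ) - 3))
            * (P.logDiff + (1 - 1 / (l : ℝ)) * Cor22.logCondAvoid P {2, l})
          + 6 * l * ((l : ℝ) + 5) / (((l : ℝ) + 4) * ((l : ℝ) - 3)) * Real.log Real.pi < Cor22.logQAvoid P {2, l}) →
      ∀ T : Cor22.ThetaVolumeDatumAt P l,
        (letI := T.instFieldF; letI := T.instNumberFieldF; letI := T.instAlgebraF; letI := T.instFieldK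
         letI := T.instNumberFieldK; letI := T.instAlgebraK; letI := T.instFieldFbar; letI := T.instAlgebraFbar
         letI := T.instAlgebraKFbar; letI := T.instIsElliptic
         ¬ (∀ p ∈ T.I.supportPrimes, ∀ v w : placesOver (fieldOfModuli T.E) p,
            (Summit.ABC.IUTFork.DHData.ofInput T.I).logQloc p v = (Summit.ABC.IUTFork.DHData.ofInput T.I).logQloc p w)) →
        T.HullEstimateOf
          (((l : ℝ) + 1) / 4 *
            ((1 + 12 * (Cor22.dmod P : ℝ) / l) * (P.logDiff + Cor22.logCondAvoid P {2, l})
              + 2 * Real.log l + 52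
              + 20 / 3 * Real.log (((2 ^ 12 * 3 ^ 3 * 5 * Cor22.dmod P : ℕ) : ℝ) * (l : ℝ))
                * (Nat.primeCounting (2 ^ 12 * 3 ^ 3 * 5 * Cor22.dmod P * l) : ℝ))))
    : _root_.ABC :=
  abc_of_inSigma_v10K_window_szpiroBadAll (M := M) (archPk := archPk) (archSub := archSub) (Ψ := Ψ) (act := act) (Mmod := Mmod)
    (region := region) (frobAdm := frobAdm) (frobLogvol := frobLogvol) (frobΨ := frobΨ) (frobMmod := frobMmod) (unitImage := unitImage)
    (ballImage := ballImage) (thetaDiv := thetaDiv) (n := n) (lat := lat) (sig := sig) (split := split) (qData := qData) (qK := qK)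
    (hNumBad := hNumBad) (hregBad := hregBad) (hSigmaBad := hSigma15Bad)
    (hdoor := fun P l T h => by
      letI := T.instFieldF; letI := T.instNumberFieldF; letI := T.instAlgebraF; letI := T.instFieldK
      letI := T.instNumberFieldK; letI := T.instAlgebraK; letI := T.instFieldFbar; letI := T.instAlgebraFbar
      letI := T.instAlgebraKFbar; letI := T.instIsElliptic
      obtain ⟨n₀, lam, mq, hn₀, hlam, hmq, hH⟩ := h
      exact pilotKummerCompatHull_chosen_of_slotReachWindowK T.D (M P l T) (archPk P l T) (archSub P l T) (Ψ P l T) (act P l T)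
        (Mmod P l T) (region P l T) (frobAdm P l T) (frobLogvol P l T) (frobΨ P l T) (frobMmod P l T) (unitImage P l T) (ballImage P l T)
        (thetaDiv P l T) (n P l T) (lat P l T) (sig P l T) (split P l T) (qData P l T) (qK P l T) n₀ lam mq hn₀ hlam hmq hH)

end Recut

end Summit.ABC.IUTFork.Repair.RH2SigmaHull

end
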